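import Literature.AlgebraicGeometry.GroupSchemes.FiniteFlatGroupSchemeRankPointCount
import Literature.AlgebraicGeometry.GroupSchemes.EtaleOfTrivialUnitComponent
import Literature.AlgebraicGeometry.Morphisms.ClosedImmersionOfEqualRank
import Mathlib.AlgebraicGeometry.Morphisms.FlatRank
import HarnessLib

/-!
# The dichotomy core over an algebraically closed field: ONE rational point ⟹ the unit component is everything; AS MANY points AS THE
# RANK ⟹ étale ([Tate1997FiniteFlatGroupSchemes] (3.7); [StacksProject] Tags 02KA, 00U3)

Topic `Literature/AlgebraicGeometry/GroupSchemes`; namespace `Literature.AlgebraicGeometry.GroupSchemes`.  THEOREMS ONLY (no definition, no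
named fact, no instance, no notation, no `sorry`).  Cell `hodgecm-mathlib`, P6 «MOD programme», desk F0P6c-plan (g0) organ **(O-b1k)**
`isIso_or_etale_of_natCard` (F0P6b-plan hand-over memo 9c697d37 §4, VERBATIM shape; re-homed to F0P3a-p04 (g15) 2026-09-01T14:48:29Z): for a finite
group scheme `G` over an algebraically closed field `k` (a group object of `Over (Spec k)` with `G → Spec k` finite) and a unit component `j : G₀ ↪ G`
(homomorphic open-and-closed immersion with connected source — the P6b line's `IsUnitComponent G G₀ j`, unfolded):
* `#G(k) = 1 ⟹ j` is an ISOMORPHISM (the count ★ `rank G = #G(k) · rank G₀` gives `rank G₀ = rank G`; equal-rank rigidity ★ Tag 02KA);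
* `#G(k) = rank G ⟹ G → Spec k` is ÉTALE (the count gives `rank G₀ = 1`, i.e. `G₀ = Spec k`, ★ `etale_and_natCard_eq_of_isUnitComponent_of_finrank_eq_one`).
Here `G(k) = (𝟙_ ⟶ G)` (sections) and `rank G = dim_k Γ(G, 𝒪_G)`.  CONSUMER: the DICT constructor (b) `eq_kerF_or_isEtale` (one name per branch).

* §1 `flat_hom_of_field'` (every `k`-scheme is flat over `Spec k`), `hom_finrank_eq_finrank_alg` (`G.hom.finrank s = dim_k Γ(G)` for `G` finite over a field),
  `natCard_sections_eq_natCard_algHom` (`#(𝟙_ ⟶ G) = #(Γ(G) →ₐ[k] k)`).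
* §2 `finrank_alg_eq_natCard_sections_mul` — the count `dim_k Γ(G) = #(𝟙_ ⟶ G) · dim_k Γ(G₀)` in sections currency (★ `Henselian.finrank_eq_natCard_algHom_mul_finrank_unitCorner`
  at `R = k` + ★ `exists_unitIdempotent_algEquiv_of_isUnitComponent`).
* §3 HEAD **`isIso_or_etale_of_natCard`** (Γ-currency) and **`isIso_or_etale_of_natCard_of_presentation`** (presentation `eB : G.left ≅ Spec B`, `dim_k B`).

HC_CM is proved only modulo the printed citations until rung 0 closes; generic algebraic geometry, no count changes.

## References
* [Tate1997FiniteFlatGroupSchemes] J. Tate, *Finite flat group schemes* (1997), (3.7) («`rank G = #G(k̄) · rank G⁰`», `G⁰ = G` iff `G(k̄) = 1`, `G` étale iff `G⁰ = 1`).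
* [StacksProject] The Stacks Project, Tag 02KA (closed immersion of equal rank between finite flat schemes is an iso), Tag 00U3 (étale algebras over fields).
* [MumfordAV1970] D. Mumford, *Abelian Varieties* (1970), §5 pp. 46–47 (flatness over a field), §12.
-/

set_option autoImplicit false

noncomputable section

universe u

open CategoryTheory CategoryTheory.Limits AlgebraicGeometry MonoidalCategory CartesianMonoidalCategory IsLocalRing
open scoped MonObj

namespace Literature.AlgebraicGeometry.GroupSchemes

open Literature.AlgebraicGeometry.Motives (SchemeOver specOver)

/-! ## §1 Flatness over a field; the rank of a finite `k`-scheme; sections as algebra maps -/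

section Field

variable {k : Type u} [Field k]

/-- The structure morphism of a scheme over a FIELD is flat (every `k`-module is flat; checked on an affine cover).
[cite: MumfordAV1970, §5 (pp. 46–47)] -/
theorem flat_hom_of_field' (Z : Over (Spec (.of k))) : Flat Z.hom := by
  rw [IsZariskiLocalAtSource.iff_of_openCover (P := @Flat) Z.left.affineCover]
  intro i
  obtain ⟨φ, hφ⟩ := Spec.map_surjective (Z.left.affineCover.f i ≫ Z.hom)
  have hflat : Flat (Spec.map φ) := by
    rw [HasRingHomProperty.Spec_iff (P := @Flat)]
    letI := φ.hom.toAlgebra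
    exact RingHom.flat_algebraMap_iff.mpr (inferInstance : Module.Flat k _)
  rwa [hφ] at hflat

/-- **The rank function of a finite `k`-scheme is the dimension of its coordinate ring**: `G.hom.finrank s = dim_k Γ(G, 𝒪_G)` at the point `s`
of `Spec k` (`G ≅ Spec Γ(G)` over `k`; Mathlib `Scheme.Hom.finrank_SpecMap_algebraMap`, `Module.rankAtStalk_eq_finrank_of_free`).
[cite: StacksProject, Tag 02KA] -/
theorem hom_finrank_eq_finrank_alg (G : Over (Spec (.of k))) [IsFinite G.hom] (s : PrimeSpectrum k) :
    G.hom.finrank s = Module.finrank k (AffineGroupScheme.Alg G) := by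
  haveI : IsAffine G.left := AffineGroupScheme.isAffine_left_of_isAffineHom G
  haveI : Flat G.hom := flat_hom_of_field' G
  set φ : CommRingCat.of k ⟶ Γ(G.left, ⊤) := (Scheme.ΓSpecIso (.of k)).inv ≫ G.hom.appTop with hφ
  have hg : G.hom = G.left.isoSpec.hom ≫ Spec.map φ := by
    rw [← Iso.inv_comp_eq]
    exact Literature.AlgebraicGeometry.Morphisms.isoSpec_inv_comp_eq G.hom
  haveI hfinI : IsFinite (Spec.map φ) := by
    have h := ‹IsFinite G.hom›
    rw [hg] at h
    exact (MorphismProperty.cancel_left_of_respectsIso @IsFinite _ _).mp h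
  haveI hflI : Flat (Spec.map φ) := by
    have h := ‹Flat G.hom›
    rw [hg] at h
    exact (MorphismProperty.cancel_left_of_respectsIso @Flat _ _).mp h
  have hfin : φ.hom.Finite := (IsFinite.SpecMap_iff _).mp hfinI
  have hfl : φ.hom.Flat := Flat.SpecMap_iff.mp hflI
  rw [hg, Scheme.Hom.finrank_comp_left_of_isIso, Scheme.Hom.finrank_SpecMap_eq_finrank hfin hfl]
  change (letI := φ.hom.toAlgebra; Module.rankAtStalk (R := k) Γ(G.left, ⊤) s) = _
  algebraize [φ.hom]
  rw [Literature.AlgebraicGeometry.Morphisms.rankAtStalk_eq_finrank_of_isLocalRing]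
  rfl

/-- **Sections are rational points of the coordinate ring**: `#(𝟙_ ⟶ G) = #(Γ(G, 𝒪_G) →ₐ[k] k)` for `G` affine over the field `k` (★ `AffineGroupScheme.ptEquiv`).
[cite: StacksProject, Tag 01I1] -/
theorem natCard_sections_eq_natCard_algHom (G : Over (Spec (.of k))) [IsAffine G.left] :
    Nat.card (𝟙_ (Over (Spec (.of k))) ⟶ G) = Nat.card (AffineGroupScheme.Alg G →ₐ[k] k) := by
  have h0 : Spec.map (CommRingCat.ofHom (algebraMap k k)) = 𝟙 (Spec (.of k)) := by
    rw [Algebra.algebraMap_self, CommRingCat.ofHom_id, Spec.map_id]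
  have e : (𝟙_ (Over (Spec (.of k))) ⟶ G) ≃
      {x : Spec (.of k) ⟶ G.left // x ≫ G.hom = Spec.map (CommRingCat.ofHom (algebraMap k k))} :=
    { toFun := fun g => ⟨g.left, (Over.w g).trans h0.symm⟩
      invFun := fun x => Over.homMk x.1 (x.2.trans h0)
      left_inv := fun g => by ext; rfl
      right_inv := fun x => rfl }
  rw [Nat.card_congr e]
  exact natCard_specPoints_eq_natCard_algHom (R := k) G k

end Field

/-! ## §2 The count in sections currency: `dim_k Γ(G) = #(𝟙_ ⟶ G) · dim_k Γ(G₀)` -/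

section Count

variable {k : Type u} [Field k] [IsAlgClosed k]

omit [IsAlgClosed k] in
/-- An affine `k`-scheme is PRESENTED BY ITS OWN COORDINATE RING: `X ≅ Spec Γ(X, 𝒪_X)` over `Spec k` (`isoSpec`, ★ `Morphisms.isoSpec_inv_comp_eq`).
[cite: StacksProject, Tag 01I1] -/
theorem exists_presentation_alg (X : Over (Spec (.of k))) [IsAffine X.left] :
    ∃ eB : X.left ≅ Spec (.of (AffineGroupScheme.Alg X)),
      eB.hom ≫ Spec.map (CommRingCat.ofHom (algebraMap k (AffineGroupScheme.Alg X))) = X.hom := by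
  refine ⟨X.left.isoSpec, ?_⟩
  rw [← Iso.eq_inv_comp]
  exact (Literature.AlgebraicGeometry.Morphisms.isoSpec_inv_comp_eq X.hom).symm

/-- **`dim_k Γ(G) = #G(k) · dim_k Γ(G₀)`** for a finite group scheme `G` over an algebraically closed field `k` with unit component `j : G₀ ↪ G`
(homomorphic open-and-closed immersion, `G₀` connected): Tate's count ★ `Henselian.finrank_eq_natCard_algHom_mul_finrank_unitCorner` at `R = k`
(unit corner ≃ `Γ(G₀)` by ★ `exists_unitIdempotent_algEquiv_of_isUnitComponent`, sections ≃ `k`-points of `Γ(G)`).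
[cite: Tate1997FiniteFlatGroupSchemes, (3.7)] -/
theorem finrank_alg_eq_natCard_sections_mul (G G₀ : Over (Spec (.of k))) [GrpObj G] [GrpObj G₀] (j : G₀ ⟶ G) [IsFinite G.hom]
    [IsMonHom j] [IsOpenImmersion j.left] [IsClosedImmersion j.left] [ConnectedSpace G₀.left] :
    Module.finrank k (AffineGroupScheme.Alg G) =
      Nat.card (𝟙_ (Over (Spec (.of k))) ⟶ G) * Module.finrank k (AffineGroupScheme.Alg G₀) := by
  haveI : IsAffine G.left := AffineGroupScheme.isAffine_left_of_isAffineHom G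
  haveI : IsFinite G₀.hom := (isFinite_and_flat_of_immersions j).1
  haveI : IsAffine G₀.left := AffineGroupScheme.isAffine_left_of_isAffineHom G₀
  haveI : Module.Finite k (AffineGroupScheme.Alg G) := AffineGroupScheme.Alg.moduleFinite G
  obtain ⟨eB₀, heB₀⟩ := exists_presentation_alg G₀
  obtain ⟨e, he, he1, he0, ⟨θ₀⟩⟩ :=
    exists_unitIdempotent_algEquiv_of_isUnitComponent k G G₀ j (AffineGroupScheme.Alg G₀) eB₀ heB₀
  have hk : maximalIdeal k ≤ RingHom.ker (algebraMap k k) := by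
    rw [IsLocalRing.isField_iff_maximalIdeal_eq.mp (Field.toIsField k)]; exact bot_le
  rw [natCard_sections_eq_natCard_algHom, θ₀.toLinearEquiv.finrank_eq]
  exact Literature.RingTheory.Henselian.finrank_eq_natCard_algHom_mul_finrank_unitCorner (R := k)
    (B := AffineGroupScheme.Alg G) k hk he he1 he0

omit [IsAlgClosed k] in
/-- The coordinate ring of a scheme with a point over `k` (e.g. a group scheme: the unit section) is non-trivial. [cite: StacksProject, Tag 01I1] -/
theorem nontrivial_alg_of_section (G : Over (Spec (.of k))) [IsAffine G.left] (g : 𝟙_ (Over (Spec (.of k))) ⟶ G) :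
    Nontrivial (AffineGroupScheme.Alg G) := by
  have hne : Nonempty (PrimeSpectrum (AffineGroupScheme.Alg G)) := ⟨G.left.isoSpec.hom (g.left (IsLocalRing.closedPoint k))⟩
  exact PrimeSpectrum.nonempty_iff_nontrivial.mp hne

end Count

/-! ## §3 HEAD — the dichotomy core `isIso_or_etale_of_natCard` (organ (O-b1k)) -/

section Head

/-- **(O-b1k) ONE POINT ⟹ `G⁰ = G`; AS MANY POINTS AS THE RANK ⟹ ÉTALE.**  Let `k` be algebraically closed, `G` a FINITE group scheme over `k` (a group
object of `Over (Spec k)`), `j : G₀ ⟶ G` a unit component — a homomorphism whose underlying morphism is an open and closed immersion with connected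
source (the P6b line's `IsUnitComponent G G₀ j`, unfolded).  Then:
(1) if `G` has exactly ONE section (`#G(k) = 1`), `j` is an ISOMORPHISM (`dim Γ(G₀) = dim Γ(G)` by the count, then equal-rank rigidity ★ Tag 02KA for the closed
immersion `j` between finite flat `k`-schemes);
(2) if `#G(k) = dim_k Γ(G, 𝒪_G)`, then `G → Spec k` is ÉTALE (the count forces `dim_k Γ(G₀) = 1`, i.e. `G₀ = Spec k`, ★
`etale_and_natCard_eq_of_isUnitComponent_of_finrank_eq_one`).  The rank is read in the `Γ(G, 𝒪_G)`-currency of ★ `EtaleOfTrivialUnitComponent`.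
[cite: Tate1997FiniteFlatGroupSchemes, (3.7)] [cite: StacksProject, Tag 02KA] [cite: StacksProject, Tag 00U3] -/
theorem isIso_or_etale_of_natCard :
    ∀ (k : Type u) [Field k] [IsAlgClosed k] (G G₀ : Over (Spec (.of k))) [GrpObj G] [GrpObj G₀] (j : G₀ ⟶ G),
      IsFinite G.hom → (IsMonHom j ∧ IsOpenImmersion j.left ∧ IsClosedImmersion j.left ∧ ConnectedSpace ↥G₀.left) →
        (Nat.card (𝟙_ (Over (Spec (.of k))) ⟶ G) = 1 → IsIso j) ∧
        (Nat.card (𝟙_ (Over (Spec (.of k))) ⟶ G) =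
            (letI := (Motives.algebraMapΓ G.hom).hom.toAlgebra; Module.finrank k Γ(G.left, ⊤)) → Etale G.hom) := by
  intro k _ _ G G₀ _ _ j hG hj
  obtain ⟨hmon, hop, hcl, hconn⟩ := hj
  haveI := hG; haveI := hmon; haveI := hop; haveI := hcl; haveI := hconn
  haveI : IsAffine G.left := AffineGroupScheme.isAffine_left_of_isAffineHom G
  haveI : IsFinite G₀.hom := (isFinite_and_flat_of_immersions j).1
  haveI : IsAffine G₀.left := AffineGroupScheme.isAffine_left_of_isAffineHom G₀
  haveI : Module.Finite k (AffineGroupScheme.Alg G) := AffineGroupScheme.Alg.moduleFinite G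
  have hcount := finrank_alg_eq_natCard_sections_mul G G₀ j
  refine ⟨fun h1 => ?_, fun h2 => ?_⟩
  · -- (1) one point: ranks agree, rigidity
    rw [h1, one_mul] at hcount
    haveI : Flat G.hom := flat_hom_of_field' G
    haveI : Flat G₀.hom := flat_hom_of_field' G₀
    exact Literature.AlgebraicGeometry.Morphisms.Over.isIso_of_isClosedImmersion_of_finrank_eq j fun s => by
      rw [hom_finrank_eq_finrank_alg G s, hom_finrank_eq_finrank_alg G₀ s, hcount]
  · -- (2) as many points as the rank: the unit component has rank one
    change Nat.card (𝟙_ (Over (Spec (.of k))) ⟶ G) = Module.finrank k (AffineGroupScheme.Alg G) at h2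
    haveI : Nontrivial (AffineGroupScheme.Alg G) := nontrivial_alg_of_section G η[G]
    have hpos : 0 < Module.finrank k (AffineGroupScheme.Alg G) := Module.finrank_pos
    have hd₀ : Module.finrank k (AffineGroupScheme.Alg G₀) = 1 := by
      rw [h2] at hcount
      have h := Nat.eq_of_mul_eq_mul_left hpos ((mul_one _).trans hcount)
      exact h.symm
    obtain ⟨eB₀, heB₀⟩ := exists_presentation_alg G₀
    exact (etale_and_natCard_eq_of_isUnitComponent_of_finrank_eq_one k G G₀ j hG ⟨hmon, hop, hcl, hconn⟩
      (AffineGroupScheme.Alg G₀) eB₀ heB₀ hd₀).1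

/-- **(O-b1k), PRESENTATION FORM** (the rank read on a presentation `eB : G ≅ Spec B` over `k`, as in the P6b count `stub_b1cg`): one section ⟹ `j` iso;
`#G(k) = dim_k B` ⟹ `G → Spec k` étale. [cite: Tate1997FiniteFlatGroupSchemes, (3.7)] [cite: StacksProject, Tag 02KA] -/
theorem isIso_or_etale_of_natCard_of_presentation :
    ∀ (k : Type u) [Field k] [IsAlgClosed k] (G G₀ : Over (Spec (.of k))) [GrpObj G] [GrpObj G₀] (j : G₀ ⟶ G),
      IsFinite G.hom → (IsMonHom j ∧ IsOpenImmersion j.left ∧ IsClosedImmersion j.left ∧ ConnectedSpace ↥G₀.left) →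
        ∀ (B : Type u) [CommRing B] [Algebra k B] (eB : G.left ≅ Spec (.of B)),
          eB.hom ≫ Spec.map (CommRingCat.ofHom (algebraMap k B)) = G.hom →
            (Nat.card (𝟙_ (Over (Spec (.of k))) ⟶ G) = 1 → IsIso j) ∧
            (Nat.card (𝟙_ (Over (Spec (.of k))) ⟶ G) = Module.finrank k B → Etale G.hom) := by
  intro k _ _ G G₀ _ _ j hG hj B _ _ eB heB
  obtain ⟨h1, h2⟩ := isIso_or_etale_of_natCard k G G₀ j hG hj
  haveI := hG
  haveI : IsAffine G.left := AffineGroupScheme.isAffine_left_of_isAffineHom G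
  obtain ⟨θ⟩ := nonempty_algEquiv_alg_of_presentation (R := k) G B eB heB
  refine ⟨h1, fun h => h2 ?_⟩
  rw [h, θ.toLinearEquiv.finrank_eq]
  rfl

end Head

end Literature.AlgebraicGeometry.GroupSchemes

end
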